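import Summits.HodgeConjecture.HodgeConjecture.Theorems.Ring2HypothesesDescentMotivatedExteriorSumHardLefschetz
import Literature.AlgebraicGeometry.HodgeTheory.AlgebraicClassesPullbackDimLEThree
import HarnessLib

/-!
# Ring 2 hypotheses, descent face — André's Lemme 1.3.2 on the real carriers, I: monomials and
# blocks of a pair of classes on a product `V ⊗ W`

research route conditional on HC_CM; not a corollary; Q11.4-sentence-2 already refuted in dim ≥ 3.
Cell `pub-hodge-ring2` (Hodge ladder STAGE 3), seat `ring2-b05` (binder row b05
`Ring2.Hypotheses.MotivatedImpliesAlgebraicAV`), gen 35. `HC_CM` (`Theses.RankFourFaces.CMAbelianHodge`) does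
not occur in this file; nothing here proves a case of the Hodge conjecture.

Purpose. André's Prop. 2.1 (i) (*Pour une théorie inconditionnelle des motifs*, Publ. Math. IHÉS 83 (1996),
p. 14: the motivated classes `A_mot(X)` form a sub-algebra of `H•(X)` for the cup product) rests on Lemme 1.3.2
(p. 13): for polarised `(X, L_X)`, `(Y, L_Y)`, the external product `*_{L_X} x ⊗ *_{L_Y} y` of two Lefschetz
involutions is a `ℚ`-combination of classes `(L_Xᵃ ⊗ L_Yᵇ) ∘ *_{X×Y} ∘ (L_Xᶜ ⊗ L_Yᵍ)(x ⊗ y)` — ONE involution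
`*_{X×Y}` of the product polarisation per term. The tree proves this for an abstract Weil cohomology
(`Motives/LefschetzStarExternalProduct`, "bicomponent elimination") but cannot conclude Prop. 2.1 (i) there
(`Motives/MotivatedCyclesProduct`: exterior sums of hyperplane classes are not hyperplane classes in that
axiomatics). On the real carriers `H•(X(ℂ); ℂ)` the exterior sum of two polarisation classes IS a polarisation
class (`isPolarizationClass_boxSum`, this seat, gen 34), so the elementary argument ports and closes Prop. 2.1 (i)
for `HodgeTheory.motivatedClasses` (sequel files `…BoxBlocksHardLefschetz`, `…BoxStar`, `…CupProduct`).

This file: the MONOMIALS `L₁ˢ p ⊠ L₂ᵗ q := fst^*(L_{η₁}ˢ p) ∪ snd^*(L_{η₂}ᵗ q) ∈ H•((V ⊗ W)(ℂ); ℂ)` of a pair of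
classes `p ∈ H^{i₁}(V(ℂ))`, `q ∈ H^{i₂}(W(ℂ))` and their spans in each degree (the BLOCK of `(p, q)`; written out
in every statement — no definition is introduced):

* §1 the three Lefschetz operators of `V ⊗ W` — `𝓛₁ = fst^* η₁ ∪ ·`, `𝓛₂ = snd^* η₂ ∪ ·` and
  `L_θ`, `θ = fst^* η₁ + snd^* η₂` — on cross products and monomials: `𝓛₁ (a ⊠ b) = L₁ a ⊠ b`,
  `𝓛₂ (a ⊠ b) = a ⊠ L₂ b` (graded commutativity with the even class `η₂`), `L_θ = 𝓛₁ + 𝓛₂`;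
* §2 blocks are stable under `𝓛₁ᶜ`, `𝓛₂ᵍ`, `L_θʳ`, and `L_θʳ (p ⊠ q)` lies in the span of the monomials with
  `s + t = r` (the qualitative binomial expansion of `(L₁ ⊗ 1 + 1 ⊗ L₂)ʳ`, André §1.3);
* §3 for `p`, `q` PRIMITIVE (`primitiveClasses`, Voisin I Def. 6.24) the monomials past the tops of the two
  strings vanish, so the block of degree `N` is spanned by the monomials with `s ≤ m₁`, `t ≤ m₂`
  (`i₁ + m₁ = d₁`, `i₂ + m₂ = d₂`).

No definition, no named fact, no sorry. References: Andre1996Motifs (§1.3 pp. 12–13), Kleiman1968AlgebraicCycles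
(§1.4, Thm. 2.9), VoisinHodgeI2002 (§6.2.3 Def. 6.24, Thm. 6.25), HatcherAT2002 (§3.2 Prop. 3.10, Thm. 3.11).
-/

noncomputable section

-- every declaration of this problem lives in `Summit.HodgeConjecture.HodgeConjecture.…` (summit = sub-problem)
set_option linter.dupNamespace false

open CategoryTheory AlgebraicGeometry MonoidalCategory CartesianMonoidalCategory
open Literature.AlgebraicTopology.SingularHomology Literature.Geometry.Kaehler
open Literature.AlgebraicGeometry Literature.AlgebraicGeometry.Motives
  Literature.AlgebraicGeometry.HodgeTheory

namespace Summit.HodgeConjecture.HodgeConjecture.Theorems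

variable {d₁ d₂ : ℕ} {V W : SchemeOver ℂ} (η₁ : complexBetti V 2) (η₂ : complexBetti W 2)

/-! ## §1 The operators `𝓛₁`, `𝓛₂`, `L_θ` on cross products -/

/-- **`𝓛₁ (a ⊠ b) = L₁ a ⊠ b`**: for `𝓛₁ = fst^* η₁ ∪ ·` on `H•((V ⊗ W)(ℂ); ℂ)` and a cross product
`a ⊠ b = fst^* a ∪ snd^* b`, `𝓛₁ (a ⊠ b) = fst^*(η₁ ∪ a) ∪ snd^* b` (associativity of the cup product and its
naturality under `fst^*`). [cite: HatcherAT2002, §3.2 Prop. 3.10] [cite: VoisinHodgeI2002, §6.2.3] -/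
theorem lefschetzPowTo_fst_cross {i j d i' e : ℕ} (h : i + j = d) (hi : i + 2 * 1 = i')
    (hde : d + 2 * 1 = e) (h' : i' + j = e) (a : complexBetti V i) (b : complexBetti W j) :
    lefschetzPowTo (complexBetti.map (fst V W) 2 η₁) 1 d e hde
        (cupProduct h (complexBetti.map (fst V W) i a) (complexBetti.map (snd V W) j b)) =
      cupProduct h' (complexBetti.map (fst V W) i' (lefschetzPowTo η₁ 1 i i' hi a))
        (complexBetti.map (snd V W) j b) := by
  rw [lefschetzPowTo_one_eq_cupProduct _ hde (by omega),
    ← cupProduct_assoc (show 2 + i = i' by omega) h h' (by omega), ← cupProduct_map,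
    lefschetzPowTo_one_eq_cupProduct η₁ hi (by omega)]

/-- **`𝓛₂ (a ⊠ b) = a ⊠ L₂ b`**: for `𝓛₂ = snd^* η₂ ∪ ·`, `𝓛₂ (a ⊠ b) = fst^* a ∪ snd^*(η₂ ∪ b)` (graded
commutativity, the sign `(-1)^{2i}` being `+1`). [cite: HatcherAT2002, §3.2 Thm. 3.11] [cite: VoisinHodgeI2002, §6.2.3] -/
theorem lefschetzPowTo_snd_cross {i j d j' e : ℕ} (h : i + j = d) (hj : j + 2 * 1 = j')
    (hde : d + 2 * 1 = e) (h' : i + j' = e) (a : complexBetti V i) (b : complexBetti W j) :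
    lefschetzPowTo (complexBetti.map (snd V W) 2 η₂) 1 d e hde
        (cupProduct h (complexBetti.map (fst V W) i a) (complexBetti.map (snd V W) j b)) =
      cupProduct h' (complexBetti.map (fst V W) i a)
        (complexBetti.map (snd V W) j' (lefschetzPowTo η₂ 1 j j' hj b)) := by
  rw [lefschetzPowTo_one_eq_cupProduct _ hde (by omega),
    ← cupProduct_assoc (show 2 + i = i + 2 by omega) h (show i + 2 + j = e by omega) (by omega),
    cupProduct_gradedComm_holds ℂ (ComplexPoints (V ⊗ W)) (show 2 + i = i + 2 by omega) rfl,
    Even.neg_one_pow (even_two_mul i), one_smul,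
    cupProduct_assoc rfl (show 2 + j = j' by omega) (show i + 2 + j = e by omega) h', ← cupProduct_map,
    lefschetzPowTo_one_eq_cupProduct η₂ hj (by omega)]

/-- **`L_θ = 𝓛₁ + 𝓛₂`** for `θ = fst^* η₁ + snd^* η₂` (one step; the cup product is additive in its first
argument). [cite: Andre1996Motifs, §1.3 (p. 12)] -/
theorem lefschetzPowTo_boxSum_one_eq_add {d e : ℕ} (hde : d + 2 * 1 = e) (z : complexBetti (V ⊗ W) d) :
    lefschetzPowTo (complexBetti.map (fst V W) 2 η₁ + complexBetti.map (snd V W) 2 η₂) 1 d e hde z =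
      lefschetzPowTo (complexBetti.map (fst V W) 2 η₁) 1 d e hde z +
        lefschetzPowTo (complexBetti.map (snd V W) 2 η₂) 1 d e hde z := by
  rw [lefschetzPowTo_one_eq_cupProduct _ hde (by omega), lefschetzPowTo_one_eq_cupProduct _ hde (by omega),
    lefschetzPowTo_one_eq_cupProduct _ hde (by omega), map_add, LinearMap.add_apply]

variable {η₁ η₂} {i₁ i₂ : ℕ} {p : complexBetti V i₁} {q : complexBetti W i₂}

/-! ## §2 Monomials and blocks -/

/-- Monomials lie in the block. [folklore] -/
theorem mono_mem_block (η₁ : complexBetti V 2) (η₂ : complexBetti W 2) (p : complexBetti V i₁)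
    (q : complexBetti W i₂) (s t N : ℕ) (h : i₁ + 2 * s + (i₂ + 2 * t) = N) :
    cupProduct h (complexBetti.map (fst V W) (i₁ + 2 * s) (lefschetzPowTo η₁ s i₁ (i₁ + 2 * s) rfl p))
        (complexBetti.map (snd V W) (i₂ + 2 * t) (lefschetzPowTo η₂ t i₂ (i₂ + 2 * t) rfl q)) ∈
      Submodule.span ℂ {z : complexBetti (V ⊗ W) N | ∃ (s t : ℕ) (h : i₁ + 2 * s + (i₂ + 2 * t) = N),
        z = cupProduct h (complexBetti.map (fst V W) (i₁ + 2 * s) (lefschetzPowTo η₁ s i₁ (i₁ + 2 * s) rfl p))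
          (complexBetti.map (snd V W) (i₂ + 2 * t) (lefschetzPowTo η₂ t i₂ (i₂ + 2 * t) rfl q))} :=
  Submodule.subset_span ⟨s, t, h, rfl⟩

/-- Normalisation of the degrees of a monomial: the two Lefschetz iterates may carry any proofs of their
target degrees. [folklore] -/
theorem mono_congr (s t : ℕ) {J₁ J₂ N : ℕ} (e₁ : i₁ + 2 * s = J₁) (e₂ : i₂ + 2 * t = J₂) (h' : J₁ + J₂ = N)
    (h : i₁ + 2 * s + (i₂ + 2 * t) = N) :
    cupProduct h' (complexBetti.map (fst V W) J₁ (lefschetzPowTo η₁ s i₁ J₁ e₁ p))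
        (complexBetti.map (snd V W) J₂ (lefschetzPowTo η₂ t i₂ J₂ e₂ q)) =
      cupProduct h (complexBetti.map (fst V W) (i₁ + 2 * s) (lefschetzPowTo η₁ s i₁ (i₁ + 2 * s) rfl p))
        (complexBetti.map (snd V W) (i₂ + 2 * t) (lefschetzPowTo η₂ t i₂ (i₂ + 2 * t) rfl q)) := by
  subst e₁ e₂
  rfl

/-- **`𝓛₁` shifts a monomial**: `𝓛₁ (L₁ˢ p ⊠ L₂ᵗ q) = L₁ˢ⁺¹ p ⊠ L₂ᵗ q`. [cite: VoisinHodgeI2002, §6.2.3] -/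
theorem lefschetzPowTo_fst_mono (s t N M : ℕ) (h : i₁ + 2 * s + (i₂ + 2 * t) = N) (hM : N + 2 * 1 = M)
    (h' : i₁ + 2 * (s + 1) + (i₂ + 2 * t) = M) :
    lefschetzPowTo (complexBetti.map (fst V W) 2 η₁) 1 N M hM
        (cupProduct h (complexBetti.map (fst V W) (i₁ + 2 * s) (lefschetzPowTo η₁ s i₁ (i₁ + 2 * s) rfl p))
          (complexBetti.map (snd V W) (i₂ + 2 * t) (lefschetzPowTo η₂ t i₂ (i₂ + 2 * t) rfl q))) =
      cupProduct h' (complexBetti.map (fst V W) (i₁ + 2 * (s + 1))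
          (lefschetzPowTo η₁ (s + 1) i₁ (i₁ + 2 * (s + 1)) rfl p))
        (complexBetti.map (snd V W) (i₂ + 2 * t) (lefschetzPowTo η₂ t i₂ (i₂ + 2 * t) rfl q)) := by
  rw [lefschetzPowTo_fst_cross η₁ h (show i₁ + 2 * s + 2 * 1 = i₁ + 2 * (s + 1) by omega) hM h',
    lefschetzPowTo_comp_apply η₁ (rfl : s + 1 = s + 1) rfl _ rfl p]

/-- **`𝓛₂` shifts a monomial**: `𝓛₂ (L₁ˢ p ⊠ L₂ᵗ q) = L₁ˢ p ⊠ L₂ᵗ⁺¹ q`. [cite: VoisinHodgeI2002, §6.2.3] -/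
theorem lefschetzPowTo_snd_mono (s t N M : ℕ) (h : i₁ + 2 * s + (i₂ + 2 * t) = N) (hM : N + 2 * 1 = M)
    (h' : i₁ + 2 * s + (i₂ + 2 * (t + 1)) = M) :
    lefschetzPowTo (complexBetti.map (snd V W) 2 η₂) 1 N M hM
        (cupProduct h (complexBetti.map (fst V W) (i₁ + 2 * s) (lefschetzPowTo η₁ s i₁ (i₁ + 2 * s) rfl p))
          (complexBetti.map (snd V W) (i₂ + 2 * t) (lefschetzPowTo η₂ t i₂ (i₂ + 2 * t) rfl q))) =
      cupProduct h' (complexBetti.map (fst V W) (i₁ + 2 * s) (lefschetzPowTo η₁ s i₁ (i₁ + 2 * s) rfl p))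
        (complexBetti.map (snd V W) (i₂ + 2 * (t + 1))
          (lefschetzPowTo η₂ (t + 1) i₂ (i₂ + 2 * (t + 1)) rfl q)) := by
  rw [lefschetzPowTo_snd_cross η₂ h (show i₂ + 2 * t + 2 * 1 = i₂ + 2 * (t + 1) by omega) hM h',
    lefschetzPowTo_comp_apply η₂ (rfl : t + 1 = t + 1) rfl _ rfl q]

/-- **`𝓛₁ᶜ` shifts a monomial**: `𝓛₁ᶜ (L₁ˢ p ⊠ L₂ᵗ q) = L₁ˢ⁺ᶜ p ⊠ L₂ᵗ q`. [cite: VoisinHodgeI2002, §6.2.3] -/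
theorem lefschetzPowTo_fst_pow_mono :
    ∀ (c s t : ℕ) {s' : ℕ} (_ : s + c = s') (N M : ℕ) (h : i₁ + 2 * s + (i₂ + 2 * t) = N) (hM : N + 2 * c = M)
      (h' : i₁ + 2 * s' + (i₂ + 2 * t) = M),
      lefschetzPowTo (complexBetti.map (fst V W) 2 η₁) c N M hM
          (cupProduct h (complexBetti.map (fst V W) (i₁ + 2 * s) (lefschetzPowTo η₁ s i₁ (i₁ + 2 * s) rfl p))
            (complexBetti.map (snd V W) (i₂ + 2 * t) (lefschetzPowTo η₂ t i₂ (i₂ + 2 * t) rfl q))) =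
        cupProduct h' (complexBetti.map (fst V W) (i₁ + 2 * s')
            (lefschetzPowTo η₁ s' i₁ (i₁ + 2 * s') rfl p))
          (complexBetti.map (snd V W) (i₂ + 2 * t) (lefschetzPowTo η₂ t i₂ (i₂ + 2 * t) rfl q))
  | 0, s, t, s', hs, N, M, h, hM, h' => by
    obtain rfl : M = N := by omega
    obtain rfl : s' = s := by omega
    rw [lefschetzPowTo_zero_eq_id, LinearMap.id_apply]
  | c + 1, s, t, s', hs, N, M, h, hM, h' => by
    obtain rfl : s' = s + c + 1 := by omega
    rw [← lefschetzPowTo_comp_apply _ (show c + 1 = c + 1 from rfl) (rfl : N + 2 * c = N + 2 * c)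
        (show N + 2 * c + 2 * 1 = M by omega) hM,
      lefschetzPowTo_fst_pow_mono c s t (rfl : s + c = s + c) N (N + 2 * c) h rfl (by omega),
      lefschetzPowTo_fst_mono (s + c) t _ M (by omega) (by omega) h']

/-- **`𝓛₂ᵍ` shifts a monomial**: `𝓛₂ᵍ (L₁ˢ p ⊠ L₂ᵗ q) = L₁ˢ p ⊠ L₂ᵗ⁺ᵍ q`. [cite: VoisinHodgeI2002, §6.2.3] -/
theorem lefschetzPowTo_snd_pow_mono :
    ∀ (g s t : ℕ) {t' : ℕ} (_ : t + g = t') (N M : ℕ) (h : i₁ + 2 * s + (i₂ + 2 * t) = N) (hM : N + 2 * g = M)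
      (h' : i₁ + 2 * s + (i₂ + 2 * t') = M),
      lefschetzPowTo (complexBetti.map (snd V W) 2 η₂) g N M hM
          (cupProduct h (complexBetti.map (fst V W) (i₁ + 2 * s) (lefschetzPowTo η₁ s i₁ (i₁ + 2 * s) rfl p))
            (complexBetti.map (snd V W) (i₂ + 2 * t) (lefschetzPowTo η₂ t i₂ (i₂ + 2 * t) rfl q))) =
        cupProduct h' (complexBetti.map (fst V W) (i₁ + 2 * s) (lefschetzPowTo η₁ s i₁ (i₁ + 2 * s) rfl p))
          (complexBetti.map (snd V W) (i₂ + 2 * t')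
            (lefschetzPowTo η₂ t' i₂ (i₂ + 2 * t') rfl q))
  | 0, s, t, t', ht, N, M, h, hM, h' => by
    obtain rfl : M = N := by omega
    obtain rfl : t' = t := by omega
    rw [lefschetzPowTo_zero_eq_id, LinearMap.id_apply]
  | g + 1, s, t, t', ht, N, M, h, hM, h' => by
    obtain rfl : t' = t + g + 1 := by omega
    rw [← lefschetzPowTo_comp_apply _ (show g + 1 = g + 1 from rfl) (rfl : N + 2 * g = N + 2 * g)
        (show N + 2 * g + 2 * 1 = M by omega) hM,
      lefschetzPowTo_snd_pow_mono g s t (rfl : t + g = t + g) N (N + 2 * g) h rfl (by omega),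
      lefschetzPowTo_snd_mono s (t + g) _ M (by omega) (by omega) h']

/-- `𝓛₁ᶜ` maps blocks to blocks. [folklore] -/
theorem lefschetzPowTo_fst_pow_mem_block (c : ℕ) {N M : ℕ} (hM : N + 2 * c = M) {z : complexBetti (V ⊗ W) N}
    (hz : z ∈ Submodule.span ℂ {z : complexBetti (V ⊗ W) N | ∃ (s t : ℕ) (h : i₁ + 2 * s + (i₂ + 2 * t) = N),
        z = cupProduct h (complexBetti.map (fst V W) (i₁ + 2 * s) (lefschetzPowTo η₁ s i₁ (i₁ + 2 * s) rfl p))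
          (complexBetti.map (snd V W) (i₂ + 2 * t) (lefschetzPowTo η₂ t i₂ (i₂ + 2 * t) rfl q))}) :
    lefschetzPowTo (complexBetti.map (fst V W) 2 η₁) c N M hM z ∈
      Submodule.span ℂ {z : complexBetti (V ⊗ W) M | ∃ (s t : ℕ) (h : i₁ + 2 * s + (i₂ + 2 * t) = M),
        z = cupProduct h (complexBetti.map (fst V W) (i₁ + 2 * s) (lefschetzPowTo η₁ s i₁ (i₁ + 2 * s) rfl p))
          (complexBetti.map (snd V W) (i₂ + 2 * t) (lefschetzPowTo η₂ t i₂ (i₂ + 2 * t) rfl q))} := by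
  induction hz using Submodule.span_induction with
  | mem z hz =>
    obtain ⟨s, t, h, rfl⟩ := hz
    rw [lefschetzPowTo_fst_pow_mono c s t rfl N M h hM (by omega)]
    exact mono_mem_block η₁ η₂ p q _ _ _ _
  | zero => rw [map_zero]; exact zero_mem _
  | add z z' _ _ hz hz' => rw [map_add]; exact add_mem hz hz'
  | smul a z _ hz => rw [map_smul]; exact Submodule.smul_mem _ a hz

/-- `𝓛₂ᵍ` maps blocks to blocks. [folklore] -/
theorem lefschetzPowTo_snd_pow_mem_block (g : ℕ) {N M : ℕ} (hM : N + 2 * g = M) {z : complexBetti (V ⊗ W) N}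
    (hz : z ∈ Submodule.span ℂ {z : complexBetti (V ⊗ W) N | ∃ (s t : ℕ) (h : i₁ + 2 * s + (i₂ + 2 * t) = N),
        z = cupProduct h (complexBetti.map (fst V W) (i₁ + 2 * s) (lefschetzPowTo η₁ s i₁ (i₁ + 2 * s) rfl p))
          (complexBetti.map (snd V W) (i₂ + 2 * t) (lefschetzPowTo η₂ t i₂ (i₂ + 2 * t) rfl q))}) :
    lefschetzPowTo (complexBetti.map (snd V W) 2 η₂) g N M hM z ∈
      Submodule.span ℂ {z : complexBetti (V ⊗ W) M | ∃ (s t : ℕ) (h : i₁ + 2 * s + (i₂ + 2 * t) = M),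
        z = cupProduct h (complexBetti.map (fst V W) (i₁ + 2 * s) (lefschetzPowTo η₁ s i₁ (i₁ + 2 * s) rfl p))
          (complexBetti.map (snd V W) (i₂ + 2 * t) (lefschetzPowTo η₂ t i₂ (i₂ + 2 * t) rfl q))} := by
  induction hz using Submodule.span_induction with
  | mem z hz =>
    obtain ⟨s, t, h, rfl⟩ := hz
    rw [lefschetzPowTo_snd_pow_mono g s t rfl N M h hM (by omega)]
    exact mono_mem_block η₁ η₂ p q _ _ _ _
  | zero => rw [map_zero]; exact zero_mem _
  | add z z' _ _ hz hz' => rw [map_add]; exact add_mem hz hz'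
  | smul a z _ hz => rw [map_smul]; exact Submodule.smul_mem _ a hz

/-- **`L_θ` on a monomial** (`θ = fst^* η₁ + snd^* η₂`): `L_θ (L₁ˢ p ⊠ L₂ᵗ q) = L₁ˢ⁺¹ p ⊠ L₂ᵗ q + L₁ˢ p ⊠ L₂ᵗ⁺¹ q`
(André §1.3: the Künneth isomorphism is `𝔰𝔩₂`-equivariant, `L_θ = L₁ ⊗ 1 + 1 ⊗ L₂`).
[cite: Andre1996Motifs, §1.3 (p. 12)] [cite: Kleiman1968AlgebraicCycles, Thm. 2.9] -/
theorem lefschetzPowTo_boxSum_one_mono (s t N M : ℕ) (h : i₁ + 2 * s + (i₂ + 2 * t) = N) (hM : N + 2 * 1 = M)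
    (h₁ : i₁ + 2 * (s + 1) + (i₂ + 2 * t) = M) (h₂ : i₁ + 2 * s + (i₂ + 2 * (t + 1)) = M) :
    lefschetzPowTo (complexBetti.map (fst V W) 2 η₁ + complexBetti.map (snd V W) 2 η₂) 1 N M hM
        (cupProduct h (complexBetti.map (fst V W) (i₁ + 2 * s) (lefschetzPowTo η₁ s i₁ (i₁ + 2 * s) rfl p))
          (complexBetti.map (snd V W) (i₂ + 2 * t) (lefschetzPowTo η₂ t i₂ (i₂ + 2 * t) rfl q))) =
      cupProduct h₁ (complexBetti.map (fst V W) (i₁ + 2 * (s + 1))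
          (lefschetzPowTo η₁ (s + 1) i₁ (i₁ + 2 * (s + 1)) rfl p))
        (complexBetti.map (snd V W) (i₂ + 2 * t) (lefschetzPowTo η₂ t i₂ (i₂ + 2 * t) rfl q)) +
      cupProduct h₂ (complexBetti.map (fst V W) (i₁ + 2 * s) (lefschetzPowTo η₁ s i₁ (i₁ + 2 * s) rfl p))
        (complexBetti.map (snd V W) (i₂ + 2 * (t + 1))
          (lefschetzPowTo η₂ (t + 1) i₂ (i₂ + 2 * (t + 1)) rfl q)) := by
  rw [lefschetzPowTo_boxSum_one_eq_add, lefschetzPowTo_fst_mono s t N M h hM h₁,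
    lefschetzPowTo_snd_mono s t N M h hM h₂]

/-- `L_θʳ` maps blocks to blocks. [folklore] -/
theorem lefschetzPowTo_boxSum_mem_block :
    ∀ (r : ℕ) {N M : ℕ} (hM : N + 2 * r = M) {z : complexBetti (V ⊗ W) N},
      z ∈ Submodule.span ℂ {z : complexBetti (V ⊗ W) N | ∃ (s t : ℕ) (h : i₁ + 2 * s + (i₂ + 2 * t) = N),
        z = cupProduct h (complexBetti.map (fst V W) (i₁ + 2 * s) (lefschetzPowTo η₁ s i₁ (i₁ + 2 * s) rfl p))
          (complexBetti.map (snd V W) (i₂ + 2 * t) (lefschetzPowTo η₂ t i₂ (i₂ + 2 * t) rfl q))} →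
      lefschetzPowTo (complexBetti.map (fst V W) 2 η₁ + complexBetti.map (snd V W) 2 η₂) r N M hM z ∈
        Submodule.span ℂ {z : complexBetti (V ⊗ W) M | ∃ (s t : ℕ) (h : i₁ + 2 * s + (i₂ + 2 * t) = M),
          z = cupProduct h (complexBetti.map (fst V W) (i₁ + 2 * s) (lefschetzPowTo η₁ s i₁ (i₁ + 2 * s) rfl p))
            (complexBetti.map (snd V W) (i₂ + 2 * t) (lefschetzPowTo η₂ t i₂ (i₂ + 2 * t) rfl q))}
  | 0, N, M, hM, z, hz => by
    obtain rfl : M = N := by omega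
    rwa [lefschetzPowTo_zero_eq_id, LinearMap.id_apply]
  | r + 1, N, M, hM, z, hz => by
    rw [← lefschetzPowTo_comp_apply _ (show r + 1 = r + 1 from rfl) (rfl : N + 2 * r = N + 2 * r)
        (show N + 2 * r + 2 * 1 = M by omega) hM]
    have ih := lefschetzPowTo_boxSum_mem_block r rfl hz
    generalize lefschetzPowTo (complexBetti.map (fst V W) 2 η₁ + complexBetti.map (snd V W) 2 η₂) r N
      (N + 2 * r) rfl z = w at ih ⊢
    induction ih using Submodule.span_induction with
    | mem w hw =>
      obtain ⟨s, t, h, rfl⟩ := hw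
      rw [lefschetzPowTo_boxSum_one_mono s t _ M h _ (by omega) (by omega)]
      exact add_mem (mono_mem_block η₁ η₂ p q _ _ _ _) (mono_mem_block η₁ η₂ p q _ _ _ _)
    | zero => rw [map_zero]; exact zero_mem _
    | add w w' _ _ hw hw' => rw [map_add]; exact add_mem hw hw'
    | smul a w _ hw => rw [map_smul]; exact Submodule.smul_mem _ a hw

/-- **`L_θʳ (p ⊠ q)` lies in the span of the monomials `L₁ˢ p ⊠ L₂ᵗ q` with `s + t = r`** (the qualitative
binomial expansion of `(L₁ ⊗ 1 + 1 ⊗ L₂)ʳ`). [cite: Andre1996Motifs, §1.3 (p. 12)] -/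
theorem lefschetzPowTo_boxSum_cross_mem_monoSpan :
    ∀ (r : ℕ) {M : ℕ} (hM : i₁ + i₂ + 2 * r = M),
      lefschetzPowTo (complexBetti.map (fst V W) 2 η₁ + complexBetti.map (snd V W) 2 η₂) r (i₁ + i₂) M hM
          (cupProduct rfl (complexBetti.map (fst V W) i₁ p) (complexBetti.map (snd V W) i₂ q)) ∈
        Submodule.span ℂ {z : complexBetti (V ⊗ W) M | ∃ (s t : ℕ) (_ : s + t = r)
          (h : i₁ + 2 * s + (i₂ + 2 * t) = M),
          z = cupProduct h (complexBetti.map (fst V W) (i₁ + 2 * s) (lefschetzPowTo η₁ s i₁ (i₁ + 2 * s) rfl p))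
            (complexBetti.map (snd V W) (i₂ + 2 * t) (lefschetzPowTo η₂ t i₂ (i₂ + 2 * t) rfl q))}
  | 0, M, hM => by
    obtain rfl : M = i₁ + i₂ := by omega
    rw [lefschetzPowTo_zero_eq_id, LinearMap.id_apply]
    exact Submodule.subset_span ⟨0, 0, rfl, rfl, rfl⟩
  | r + 1, M, hM => by
    rw [← lefschetzPowTo_comp_apply _ (show r + 1 = r + 1 from rfl) (rfl : i₁ + i₂ + 2 * r = i₁ + i₂ + 2 * r)
        (show i₁ + i₂ + 2 * r + 2 * 1 = M by omega) hM]
    have ih := lefschetzPowTo_boxSum_cross_mem_monoSpan r (M := i₁ + i₂ + 2 * r) rfl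
    generalize lefschetzPowTo (complexBetti.map (fst V W) 2 η₁ + complexBetti.map (snd V W) 2 η₂) r (i₁ + i₂)
      (i₁ + i₂ + 2 * r) rfl (cupProduct rfl (complexBetti.map (fst V W) i₁ p) (complexBetti.map (snd V W) i₂ q)) = w
      at ih ⊢
    induction ih using Submodule.span_induction with
    | mem w hw =>
      obtain ⟨s, t, hst, h, rfl⟩ := hw
      rw [lefschetzPowTo_boxSum_one_mono s t _ M h _ (by omega) (by omega)]
      exact add_mem (Submodule.subset_span ⟨s + 1, t, by omega, by omega, rfl⟩)
        (Submodule.subset_span ⟨s, t + 1, by omega, by omega, rfl⟩)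
    | zero => rw [map_zero]; exact zero_mem _
    | add w w' _ _ hw hw' => rw [map_add]; exact add_mem hw hw'
    | smul a w _ hw => rw [map_smul]; exact Submodule.smul_mem _ a hw

/-! ## §3 Primitive pairs: the monomials past the tops vanish -/

/-- A monomial `L₁ˢ p ⊠ L₂ᵗ q` with `p ∈ P^{i₁}(V)` primitive (for `η₁`, dimension `d₁`) and `i₁ + s > d₁`
vanishes (`Lˢ` kills `P^{i₁}` past the top of its string, Voisin I Def. 6.24). [cite: VoisinHodgeI2002, §6.2.3 Def. 6.24] -/
theorem mono_eq_zero_left (hp : p ∈ primitiveClasses η₁ d₁ i₁) {s t N : ℕ}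
    (h : i₁ + 2 * s + (i₂ + 2 * t) = N) (hs : d₁ + 1 ≤ i₁ + s) :
    cupProduct h (complexBetti.map (fst V W) (i₁ + 2 * s) (lefschetzPowTo η₁ s i₁ (i₁ + 2 * s) rfl p))
        (complexBetti.map (snd V W) (i₂ + 2 * t) (lefschetzPowTo η₂ t i₂ (i₂ + 2 * t) rfl q)) = 0 := by
  rw [lefschetzPowTo_eq_zero_of_mem_primitiveClasses hp rfl hs, map_zero, LinearMap.map_zero₂]

/-- A monomial `L₁ˢ p ⊠ L₂ᵗ q` with `q ∈ P^{i₂}(W)` primitive (for `η₂`, dimension `d₂`) and `i₂ + t > d₂`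
vanishes. [cite: VoisinHodgeI2002, §6.2.3 Def. 6.24] -/
theorem mono_eq_zero_right (hq : q ∈ primitiveClasses η₂ d₂ i₂) {s t N : ℕ}
    (h : i₁ + 2 * s + (i₂ + 2 * t) = N) (ht : d₂ + 1 ≤ i₂ + t) :
    cupProduct h (complexBetti.map (fst V W) (i₁ + 2 * s) (lefschetzPowTo η₁ s i₁ (i₁ + 2 * s) rfl p))
        (complexBetti.map (snd V W) (i₂ + 2 * t) (lefschetzPowTo η₂ t i₂ (i₂ + 2 * t) rfl q)) = 0 := by
  rw [lefschetzPowTo_eq_zero_of_mem_primitiveClasses hq rfl ht, map_zero, map_zero]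

/-- For `p ∈ P^{i₁}(V)`, `q ∈ P^{i₂}(W)` primitive (`i₁ + m₁ = d₁`, `i₂ + m₂ = d₂`) the block of degree `N` is
spanned by the monomials `L₁ˢ p ⊠ L₂ᵗ q` with `s ≤ m₁`, `t ≤ m₂` (the others vanish).
[cite: VoisinHodgeI2002, §6.2.3 Def. 6.24] -/
theorem block_eq_span_range (hp : p ∈ primitiveClasses η₁ d₁ i₁) (hq : q ∈ primitiveClasses η₂ d₂ i₂)
    {m₁ m₂ : ℕ} (hm₁ : i₁ + m₁ = d₁) (hm₂ : i₂ + m₂ = d₂) (N : ℕ) :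
    Submodule.span ℂ {z : complexBetti (V ⊗ W) N | ∃ (s t : ℕ) (h : i₁ + 2 * s + (i₂ + 2 * t) = N),
        z = cupProduct h (complexBetti.map (fst V W) (i₁ + 2 * s) (lefschetzPowTo η₁ s i₁ (i₁ + 2 * s) rfl p))
          (complexBetti.map (snd V W) (i₂ + 2 * t) (lefschetzPowTo η₂ t i₂ (i₂ + 2 * t) rfl q))} =
      Submodule.span ℂ (Set.range fun st : {st : Fin (m₁ + 1) × Fin (m₂ + 1) //
          i₁ + 2 * (st.1 : ℕ) + (i₂ + 2 * (st.2 : ℕ)) = N} ↦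
        cupProduct st.2 (complexBetti.map (fst V W) (i₁ + 2 * (st.1.1 : ℕ))
            (lefschetzPowTo η₁ (st.1.1 : ℕ) i₁ (i₁ + 2 * (st.1.1 : ℕ)) rfl p))
          (complexBetti.map (snd V W) (i₂ + 2 * (st.1.2 : ℕ))
            (lefschetzPowTo η₂ (st.1.2 : ℕ) i₂ (i₂ + 2 * (st.1.2 : ℕ)) rfl q))) := by
  refine le_antisymm (Submodule.span_le.2 ?_) (Submodule.span_mono ?_)
  · rintro z ⟨s, t, h, rfl⟩
    by_cases hs : d₁ + 1 ≤ i₁ + s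
    · rw [mono_eq_zero_left hp h hs]
      exact zero_mem _
    by_cases ht : d₂ + 1 ≤ i₂ + t
    · rw [mono_eq_zero_right hq h ht]
      exact zero_mem _
    exact Submodule.subset_span ⟨⟨(⟨s, by omega⟩, ⟨t, by omega⟩), h⟩, rfl⟩
  · rintro _ ⟨st, rfl⟩
    exact ⟨_, _, st.2, rfl⟩

end Summit.HodgeConjecture.HodgeConjecture.Theorems

end
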